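import Summits.HodgeConjecture.HodgeConjecture.Theorems.MarkmanPartnerTransportPartnerTransportLattice
import Literature.AlgebraicGeometry.Hyperkaehler.K3HilbertTypeHodgeIsometryLift
import Literature.AlgebraicGeometry.HodgeTheory.HodgeModelExistence

/-!
# Route MarkmanPartnerTransport · support `PartnerTransport` (stmt-HodgeConjecture-19650) —
# rational Hodge maps between marked `K3^{[2]}`-type fourfolds: reality, Néron–Severi, and the INVERSE of a
# marked rational Hodge isometry

Bookkeeping for transporting endomorphism hypotheses (`E = ℚ`, «spanned by isometries») along the marked
rational Hodge isometry `f : H²(S^{[2]}) ⥲ H²(X)` of `exists_markedHodgeIsometry_of_partner`: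

* `mem_span_ratCast_top` — `ℂ²³` is the complex span of `ℚ²³`;
* `conjClass_map_of_isRationalClass` — a `ℂ`-linear map `H²(H) → H²(X)` preserving rational classes
  commutes with complex conjugation (both fourfolds integrally marked);
* `map_mem_algebraicClasses_of_isRationalClass_of_oneOne` — a rational, `(1,1)`-preserving map sends
  `N¹(H)` into `N¹(X)` (Lefschetz `(1,1)`, `N¹` spanned by rational classes) — any smooth projective `H, X`;
* `exists_inverse_markedHodgeIsometry` — **the inverse of a bijective marked rational Hodge isometry is a
  marked rational Hodge isometry** (rationality by a dimension count over `ℚ`, Hodge types through the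
  period lines, (m4)–(m5), the isometry and reality).

No definition, no sorry, no named fact. Prover seat hodge-nonav-19652-p1 (gen 6),
`--supports stmt-HodgeConjecture-19650`.

References: C. Voisin, *Hodge Theory I* Cor. 6.12, §7.1.1, Thm. 11.30; A. Beauville, J. Differential
Geom. 18 (1983) §8–9; E. Markman, Compos. Math. 160 (2024) §1.1.
-/

noncomputable section

set_option linter.dupNamespace false

open scoped Matrix
open Module CategoryTheory MonoidalCategory
open Literature.AlgebraicTopology.SingularHomology Literature.Geometry.Kaehler
open Literature.AlgebraicGeometry Literature.AlgebraicGeometry.Motives Literature.AlgebraicGeometry.HodgeTheory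
open Literature.AlgebraicGeometry.Hyperkaehler Literature.AlgebraicGeometry.Surfaces
open Summit.HodgeConjecture.HodgeConjecture.Theorems.NikulinTwinTransport
open Summit.HodgeConjecture.HodgeConjecture.Theorems.MarkmanPartnerTransport.BBFPositivity

namespace Summit.HodgeConjecture.HodgeConjecture.Theorems.MarkmanPartnerTransport.PartnerLattice

/-- `MarkedK3Sq[X, φ, P, z]`: VERBATIM the `let MarkedK3Sq := …` binder of the route declarations of
MarkmanPartnerTransport (clauses (m1)–(m6)). Local notation only. -/
local notation3 (prettyPrint := false) "MarkedK3Sq[" X ", " φ ", " P ", " z "]" =>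
  (((IsIntegralClass P ∧ ∀ Q : complexBetti X (2 * 4), IsIntegralClass Q → ∃ n : ℤ, Q = n • P) ∧
    (∀ c : complexBetti X 2, IsIntegralClass c ↔ ∃ v : K3HilbertIndex → ℤ, φ c = fun i => (v i : ℂ)) ∧
    (∀ a : complexBetti X 2, cupPowTwo a 4 = ((3 : ℂ) * (k3HilbertForm 2 (φ a) (φ a)) ^ 2) • P) ∧
    (IsOfHodgeType 4 X 2 2 0 (LinearEquiv.symm φ z) ∧
      ∀ τ : complexBetti X 2, IsOfHodgeType 4 X 2 2 0 τ → ∃ t : ℂ, τ = t • LinearEquiv.symm φ z) ∧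
    (∀ c : complexBetti X 2, IsOfHodgeType 4 X 2 1 1 c ↔
      (k3HilbertForm 2 (φ c) z = 0 ∧ k3HilbertForm 2 (φ c) (star z) = 0)) ∧
    (k3HilbertForm 2 z z = 0 ∧ 0 < (k3HilbertForm 2 (star z) z).re)))

/-- `cz[τ]` = the complexification of a `ℚ`-linear `τ : ℚ²³ → ℚ²³`. Local notation only. -/
local notation3 (prettyPrint := false) "cz[" τ "]" =>
  Matrix.toLin' (Matrix.map (LinearMap.toMatrix' (R := ℚ) τ) (Rat.cast : ℚ → ℂ))

/-! ### `ℂ²³ = ℚ²³ ⊗ ℂ` -/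

/-- Every vector of `ℂ²³` lies in the complex span of the rational vectors. [folklore] -/
theorem mem_span_ratCast_top (y : K3HilbertIndex → ℂ) :
    y ∈ Submodule.span ℂ ((fun a : K3HilbertIndex → ℚ => fun i => (a i : ℂ)) ''
      ((⊤ : Submodule ℚ (K3HilbertIndex → ℚ)) : Set (K3HilbertIndex → ℚ))) := by
  have : y ∈ Submodule.span ℂ (Set.range (Pi.basisFun ℂ K3HilbertIndex)) := by
    rw [(Pi.basisFun ℂ K3HilbertIndex).span_eq]; exact Submodule.mem_top
  refine Submodule.span_mono ?_ this
  rintro _ ⟨i, rfl⟩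
  exact ⟨Pi.single i 1, Submodule.mem_top, by
    funext k; by_cases hk : k = i <;> simp [Pi.basisFun_apply, hk]⟩

/-! ### Rational maps are real -/

variable {H X : SchemeOver ℂ} {φH : complexBetti H 2 ≃ₗ[ℂ] (K3HilbertIndex → ℂ)}
  {φ : complexBetti X 2 ≃ₗ[ℂ] (K3HilbertIndex → ℂ)}

/-- **A `ℂ`-linear map between the `H²` of two integrally marked fourfolds which preserves rational
classes commutes with complex conjugation**: in the markings it is a rational matrix, hence real.
[cite: VoisinHodgeI2002, Cor. 6.12 and §7.1.1] -/
theorem conjClass_map_of_isRationalClass (hH : IsSmoothProjective 4 H) (hX : IsSmoothProjective 4 X)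
    (hintH : ∀ c : complexBetti H 2, IsIntegralClass c ↔ ∃ v : K3HilbertIndex → ℤ, φH c = fun i => (v i : ℂ))
    (hint : ∀ c : complexBetti X 2, IsIntegralClass c ↔ ∃ v : K3HilbertIndex → ℤ, φ c = fun i => (v i : ℂ))
    (f : complexBetti H 2 →ₗ[ℂ] complexBetti X 2) (hf : ∀ c, IsRationalClass c → IsRationalClass (f c))
    (c : complexBetti H 2) :
    f (conjClass (ComplexPoints H) 2 c) = conjClass (ComplexPoints X) 2 (f c) := by
  classical
  set L : (K3HilbertIndex → ℂ) →ₗ[ℂ] (K3HilbertIndex → ℂ) :=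
    (φ : complexBetti X 2 →ₗ[ℂ] (K3HilbertIndex → ℂ)) ∘ₗ f ∘ₗ
      (φH.symm : (K3HilbertIndex → ℂ) →ₗ[ℂ] complexBetti H 2) with hLdef
  have hLapp : ∀ y, L y = φ (f (φH.symm y)) := fun y => rfl
  have hLrat : ∀ v : K3HilbertIndex → ℚ, ∃ w : K3HilbertIndex → ℚ,
      L (fun i => (v i : ℂ)) = fun i => (w i : ℂ) := fun v => by
    rw [hLapp]
    exact (isRationalClass_iff_of_markedSq hX hint _).1
      (hf _ ((isRationalClass_iff_of_markedSq hH hintH _).2 ⟨v, LinearEquiv.apply_symm_apply _ _⟩))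
  obtain ⟨M, hM⟩ := exists_ratLinear_of_forall_ratCast L hLrat
  have hLM : ∀ y, L y = cz[M] y := fun y =>
    eq_on_span_ratCast L cz[M] _ (fun r _ => by rw [cplx_ratCast, hM]) (mem_span_ratCast_top y)
  apply φ.injective
  have h1 : conjClass (ComplexPoints H) 2 c = φH.symm (star (φH c)) := by
    apply φH.injective
    rw [marking_conjClass hintH, LinearEquiv.apply_symm_apply]
  rw [marking_conjClass hint, h1, ← hLapp, hLM, cplx_star, ← hLM, hLapp, LinearEquiv.symm_apply_apply]

/-! ### Rational `(1,1)`-preserving maps respect `N¹` -/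

/-- **A `ℂ`-linear map `H²(Y) → H²(X)` of smooth projective varieties which preserves rational classes and
the Hodge type `(1,1)` sends `N¹(Y)` into `N¹(X)`**: `N¹(Y)` is spanned by rational algebraic classes
(`supportedClasses_eq_span_isRationalClass`), which are `(1,1)`, and rational `(1,1)`-classes of `X` are
algebraic (Lefschetz `(1,1)`, `lefschetzOneOne_rational_holds`). [cite: VoisinHodgeI2002, Thm. 11.30] -/
theorem map_mem_algebraicClasses_of_isRationalClass_of_oneOne {m n : ℕ} {Y : SchemeOver ℂ}
    (hY : IsSmoothProjective m Y) (hX : IsSmoothProjective n X)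
    (f : complexBetti Y (2 * 1) →ₗ[ℂ] complexBetti X (2 * 1))
    (hf : ∀ c, IsRationalClass c → IsRationalClass (f c))
    (hf11 : ∀ c, IsOfHodgeType m Y (2 * 1) 1 1 c → IsOfHodgeType n X (2 * 1) 1 1 (f c))
    {w : complexBetti Y (2 * 1)} (hw : w ∈ algebraicClasses Y 1) : f w ∈ algebraicClasses X 1 := by
  have hspan := supportedClasses_eq_span_isRationalClass hY 2 1
  change algebraicClasses Y 1 = Submodule.span ℂ
    {c : complexBetti Y 2 | IsRationalClass c ∧ c ∈ algebraicClasses Y 1} at hspan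
  rw [hspan] at hw
  rw [← Submodule.mem_comap]
  refine (Submodule.span_le.2 ?_) hw
  rintro c ⟨hcrat, hcalg⟩
  rw [SetLike.mem_coe, Submodule.mem_comap]
  exact lefschetzOneOne_rational_holds hX (f c) (hf c hcrat)
    (hf11 c (isOfHodgeType_of_mem_algebraicClasses_of_isSmoothProjective hY 1 hcalg))

/-! ### The inverse of a marked rational Hodge isometry -/

/-- **The inverse of a bijective marked rational Hodge isometry `f : H²(H) ⥲ H²(X)` between marked smooth
projective fourfolds is again rational, Hodge and isometric.**  Rationality: in the markings `f` is an
injective, hence bijective, `ℚ`-linear endomorphism of `ℚ²³`.  Hodge types: `f(φ_H⁻¹ z_H) = t·φ⁻¹ z` with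
`t ≠ 0` ((m4) on both sides, injectivity), so `(2,0) ↦ (2,0)` backwards; `(1,1)` by (m5), the isometry and
the reality of `f` (`conjClass_map_of_isRationalClass`); `(0,2)` by conjugation; other types vanish.
[cite: VoisinHodgeI2002, §7.1.1 and Cor. 6.12] [cite: Beauville1983, §8 Thm. 5 and §9] -/
theorem exists_inverse_markedHodgeIsometry (hH : IsSmoothProjective 4 H) (hX : IsSmoothProjective 4 X)
    {PH : complexBetti H (2 * 4)} {zH : K3HilbertIndex → ℂ} (hMH : MarkedK3Sq[H, φH, PH, zH])
    {P : complexBetti X (2 * 4)} {z : K3HilbertIndex → ℂ} (hM : MarkedK3Sq[X, φ, P, z])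
    {f : complexBetti H 2 →ₗ[ℂ] complexBetti X 2} (hfbij : Function.Bijective f)
    (hfrat : ∀ c, IsRationalClass c → IsRationalClass (f c))
    (hfh : ∀ (i j : ℕ) c, IsOfHodgeType 4 H 2 i j c → IsOfHodgeType 4 X 2 i j (f c))
    (hfq : ∀ a b, k3HilbertForm 2 (φ (f a)) (φ (f b)) = k3HilbertForm 2 (φH a) (φH b)) :
    ∃ e : complexBetti H 2 ≃ₗ[ℂ] complexBetti X 2, (∀ c, e c = f c) ∧
      (∀ c, IsRationalClass c → IsRationalClass (e.symm c)) ∧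
      (∀ (i j : ℕ) c, IsOfHodgeType 4 X 2 i j c → IsOfHodgeType 4 H 2 i j (e.symm c)) ∧
      ∀ a b, k3HilbertForm 2 (φH (e.symm a)) (φH (e.symm b)) = k3HilbertForm 2 (φ a) (φ b) := by
  classical
  obtain ⟨-, hintH, -, ⟨hzH20, hzH20span⟩, h11H, ⟨-, hzHpos⟩⟩ := id hMH
  obtain ⟨-, hint, -, ⟨hz20, hz20span⟩, h11, ⟨-, hzpos⟩⟩ := id hM
  set e : complexBetti H 2 ≃ₗ[ℂ] complexBetti X 2 := LinearEquiv.ofBijective f hfbij with hedef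
  have he : ∀ c, e c = f c := fun c => rfl
  have hfe : ∀ c, f (e.symm c) = c := fun c => by rw [← he, LinearEquiv.apply_symm_apply]
  -- rationality of the inverse: `f` is a bijection of `ℚ²³` in the markings
  set L : (K3HilbertIndex → ℂ) →ₗ[ℂ] (K3HilbertIndex → ℂ) :=
    (φ : complexBetti X 2 →ₗ[ℂ] (K3HilbertIndex → ℂ)) ∘ₗ f ∘ₗ
      (φH.symm : (K3HilbertIndex → ℂ) →ₗ[ℂ] complexBetti H 2) with hLdef
  have hLapp : ∀ y, L y = φ (f (φH.symm y)) := fun y => rfl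
  have hLrat : ∀ v : K3HilbertIndex → ℚ, ∃ w : K3HilbertIndex → ℚ,
      L (fun i => (v i : ℂ)) = fun i => (w i : ℂ) := fun v => by
    rw [hLapp]
    exact (isRationalClass_iff_of_markedSq hX hint _).1
      (hfrat _ ((isRationalClass_iff_of_markedSq hH hintH _).2 ⟨v, LinearEquiv.apply_symm_apply _ _⟩))
  obtain ⟨M, hM'⟩ := exists_ratLinear_of_forall_ratCast L hLrat
  have hMinj : Function.Injective M := by
    intro a b hab
    have h1 : L (fun i => (a i : ℂ)) = L (fun i => (b i : ℂ)) := by rw [← hM', ← hM', hab]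
    rw [hLapp, hLapp] at h1
    have h2 := φH.symm.injective (hfbij.1 (φ.injective h1))
    funext i
    exact_mod_cast congrFun h2 i
  have hMsurj : Function.Surjective M := LinearMap.surjective_of_injective hMinj
  have hrat' : ∀ c, IsRationalClass c → IsRationalClass (e.symm c) := by
    intro c hc
    obtain ⟨w, hw⟩ := (isRationalClass_iff_of_markedSq hX hint c).1 hc
    obtain ⟨v, hv⟩ := hMsurj w
    refine (isRationalClass_iff_of_markedSq hH hintH _).2 ⟨v, ?_⟩
    have h1 : φ (f (φH.symm (fun i => (v i : ℂ)))) = φ c := by rw [← hLapp, ← hM', hv, hw]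
    have h2 : e.symm c = φH.symm (fun i => (v i : ℂ)) := by
      apply hfbij.1
      rw [hfe]
      exact (φ.injective h1).symm
    rw [h2, LinearEquiv.apply_symm_apply]
  -- reality of `f`
  have hfconj : ∀ c, f (conjClass (ComplexPoints H) 2 c) = conjClass (ComplexPoints X) 2 (f c) :=
    conjClass_map_of_isRationalClass hH hX hintH hint f hfrat
  -- the period lines correspond: `f (φ_H⁻¹ z_H) = t • φ⁻¹ z`, `t ≠ 0`
  obtain ⟨t, ht⟩ := hz20span _ (hfh 2 0 _ hzH20)
  have hzH0 : φH.symm zH ≠ 0 := by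
    intro h0
    rw [LinearEquiv.map_eq_zero_iff] at h0
    rw [h0] at hzHpos
    simp [k3HilbertForm] at hzHpos
  have ht0 : t ≠ 0 := by
    rintro rfl
    rw [zero_smul] at ht
    exact hzH0 (hfbij.1 (by rw [ht, map_zero]))
  have hsymmz : e.symm (φ.symm z) = t⁻¹ • φH.symm zH := by
    apply hfbij.1
    rw [hfe, map_smul, ht, smul_smul, inv_mul_cancel₀ ht0, one_smul]
  have hφfzH : φ (f (φH.symm zH)) = t • z := by rw [ht, map_smul, LinearEquiv.apply_symm_apply]
  have hφfzHbar : φ (f (φH.symm (star zH))) = star t • star z := by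
    have h2 : φH.symm (star zH) = conjClass (ComplexPoints H) 2 (φH.symm zH) := by
      apply φH.injective
      rw [marking_conjClass hintH, LinearEquiv.apply_symm_apply, LinearEquiv.apply_symm_apply]
    rw [h2, hfconj, marking_conjClass hint, hφfzH, star_smul]
  refine ⟨e, he, hrat', ?_, ?_⟩
  · -- Hodge types of the inverse
    intro i j c hc
    by_cases hij : i + j = 2
    · have hi2 : i ≤ 2 := by omega
      interval_cases i
      · -- `(0,2)` by conjugation
        have hj : j = 2 := by omega
        subst hj
        obtain ⟨s', hs'⟩ := hz20span _ (hc.conjClass hX)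
        have hsymmconj : ∀ c', e.symm (conjClass (ComplexPoints X) 2 c') =
            conjClass (ComplexPoints H) 2 (e.symm c') := fun c' => by
          apply hfbij.1
          rw [hfe, hfconj, hfe]
        rw [← conjClass_conjClass (e.symm c), ← hsymmconj]
        refine IsOfHodgeType.conjClass hH ?_
        rw [hs', map_smul, hsymmz, smul_smul]
        exact hzH20.smul _
      · -- `(1,1)`
        have hj : j = 1 := by omega
        subst hj
        obtain ⟨hc1, hc2⟩ := (h11 c).1 hc
        refine (h11H (e.symm c)).2 ⟨?_, ?_⟩
        · have h1 : k3HilbertForm 2 (φH (e.symm c)) zH =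
              k3HilbertForm 2 (φ (f (e.symm c))) (φ (f (φH.symm zH))) := by
            rw [hfq, LinearEquiv.apply_symm_apply]
          rw [h1, hfe, hφfzH, k3HilbertForm_smul_right, hc1, mul_zero]
        · have h1 : k3HilbertForm 2 (φH (e.symm c)) (star zH) =
              k3HilbertForm 2 (φ (f (e.symm c))) (φ (f (φH.symm (star zH)))) := by
            rw [hfq, LinearEquiv.apply_symm_apply]
          rw [h1, hfe, hφfzHbar, k3HilbertForm_smul_right, hc2, mul_zero]
      · -- `(2,0)`
        have hj : j = 0 := by omega
        subst hj
        obtain ⟨s', rfl⟩ := hz20span c hc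
        rw [map_smul, hsymmz, smul_smul]
        exact hzH20.smul _
    · have hc0 : c = 0 := by
        obtain ⟨A, hA⟩ := hc
        rw [(A.hodgePQ_eq_bot_iff 2 i j).2
            (Literature.NumberTheory.Transcendental.hodgePQ_eq_bot_of_ne (M := A.carrier) hij),
          Submodule.mem_bot] at hA
        exact A.pullback_injective 2 (by rw [hA, map_zero])
      rw [hc0, map_zero]
      exact isOfHodgeType_zero_of_isSmoothProjective nonempty_hodgeModel_holds hH 2 i j
  · -- isometry of the inverse
    intro a b
    rw [← hfq, hfe, hfe]

end Summit.HodgeConjecture.HodgeConjecture.Theorems.MarkmanPartnerTransport.PartnerLattice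

end
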